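import Summits.CriticalPhenomena.PercolationContinuityZ3.Theorems.Transplant.FKConnectivityAllQArborealMonotone
import HarnessLib

/-!
# MM and forest-MM hold COEFFICIENTWISE IN A UNIFORM ACTIVITY SCALING — the LEVEL nodes `ClusterDomAdjLevelOn` (`φ_{w,q}`) and
# `ArborealClusterDomAdjLevelOn` (arboreal gas), and the kernel reductions level ⇒ MM, level ⇒ forest-MM

Definitions file (`--supports stmt-CriticalPhenomena-4575`), FK sub-lane `prim-bschramm-fk-1` (gen 10) of the post-continuity programme;
builds on p205010 (kernel theorem, internal audit signed; external expert review pending).  Two definitions of level sums, two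
`@[conjecture]` nodes (NOT asserted), two reductions; no sorries; standard axioms.

FINDING OF THIS SEAT (exact integer census, bschramm/FROM-fk-1-g10-LEVELS.md).  fk-1 g7's MM (`ClusterDomAdjFKPos`: the law of `C_x`
given the pair `f = xz` open dominates its law given `f` closed, every `q > 0`) and fk-1 g9's forest-MM (`ArborealClusterDomAdjPos`) are
NOT combinatorial fiber by fiber (fix `ω ∩ ω'` and `ω ∪ ω'`: false already on `K₄ − f`, fiber `S = ∅`, `D = C₄`, `𝒰 = {T_x ⊇ {2,3}}`:
4 < 5 colourings), not in the bigrading (pairs at `x`, other pairs), and not in the activities of the pairs at `x` alone (fk-1 g8's `K₀`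
refutation) — but they DO hold coefficient by coefficient in a UNIFORM scaling `t` of all activities: writing the cross difference
`S₁Z₀ − S₀Z₁` (`S_b = Σ_ω w_b(ω)·1{C_x(ω) ∈ 𝒰}`, `Z_b = Σ_ω w_b(ω)`, `w_b` the weight with `f` revealed `b`) as a double sum over pairs
`(ω, ω')` and grading the pairs by the TOTAL number of open pairs `|ω| + |ω'|`, every graded piece is `≥ 0`:
0 violations in every level of every instance tested — forests (`q ↓ 0`): all weight vectors tried on `K₄ … K₈` and random graphs on
`≤ 7` vertices (≈ 1,300 levels, Strassen/max-flow dominance check per level over ALL up-sets); `φ_{w,q}` for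
`q ∈ {1/100, 1/30, 1/10, 1/2, 9/10, 2}` on `K₄ … K₇` and random graphs on `≤ 6` vertices (≈ 4,000 levels).  Planted-false control: ROOTED
forests fail (79/120 levels, `n = 7`).  Equivalently: MM holds for the PAIR ensemble `(ω, ω') ~ φ¹ ⊗ φ⁰` CONDITIONED on the total number
of open pairs — the form in which Harris-type inductions operate (the Harris inequality for product measure is levelwise by its
standard inductive proof).  Recorded as the nodes below; `Σ_m (level m) = S₁Z₀ − S₀Z₁` gives the reductions to MM / forest-MM.
[cite: Grimmett2006, §1.5 eq. (1.22) (p. 13); Thm. (3.21) (p. 43); §3.9 (pp. 63–65)] [cite: AyyerLinussonRavichandran2025, §7 Conj. 7.1 (p. 22)]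
-/

noncomputable section

namespace Summit.CriticalPhenomena.PercolationContinuityZ3.Theorems

namespace FK

open MeasureTheory Set Literature.Probability.LatticeModels Literature.Probability.Percolation
open scoped Classical
open BHK2006 DecisionTree

variable {V : Type*} [Fintype V]

/-! ### Level sums -/

/-- **Level `m` of the MM cross difference for `φ_{w,q}`**:
`Σ_{|ω|+|ω'| = m} w_q[f↦1](ω)·w_q[f↦0](ω')·(1{C_x(ω) ∈ 𝒰} − 1{C_x(ω') ∈ 𝒰})`, `f = s(x,z)` — the `t^m`-coefficient of
`S₁(t)Z₀(t) − S₀(t)Z₁(t)` under the uniform activity scaling `v_e ↦ t·v_e`. [cite: Grimmett2006, Thm. (3.21) (p. 43); §3.9 (p. 63)] -/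
def rcLevelCross (w : Sym2 V → unitInterval) (q : ℝ) (x z : V) (𝒰 : Set (Set V)) (m : ℕ) : ℝ :=
  ∑ ω : BondConfig V, ∑ ω' : BondConfig V, (if ω.ncard + ω'.ncard = m then (1 : ℝ) else 0) *
    (rcWeightW (Function.update w s(x, z) 1) q ∅ ω * rcWeightW (Function.update w s(x, z) 0) q ∅ ω' *
      (ind (clusterIn x 𝒰) ω - ind (clusterIn x 𝒰) ω'))

/-- **Level `m` of the forest-MM cross difference for the arboreal gas**:
`Σ_{|ω|+|ω'| = m} agWeight_{w[f↦1]}(ω)·agWeight_{w[f↦0]}(ω')·(1{T_x(ω) ∈ 𝒰} − 1{T_x(ω') ∈ 𝒰})`, `f = s(x,z)`.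
[cite: Grimmett2006, §1.5 eq. (1.22) (p. 13)] [cite: AyyerLinussonRavichandran2025, §7 Conj. 7.1 (p. 22)] -/
def agLevelCross (w : Sym2 V → unitInterval) (x z : V) (𝒰 : Set (Set V)) (m : ℕ) : ℝ :=
  ∑ ω : BondConfig V, ∑ ω' : BondConfig V, (if ω.ncard + ω'.ncard = m then (1 : ℝ) else 0) *
    (agWeight (setW w s(x, z) true) ω * agWeight (setW w s(x, z) false) ω' *
      (ind (clusterIn x 𝒰) ω - ind (clusterIn x 𝒰) ω'))

/-! ### The level nodes (conjecture-shaped, NOT asserted) -/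

/-- **Levelwise MM on the vertex type `V`**: every level of the MM cross difference is nonnegative, for every weight vector, pair at
`x` and up-set.  Conjectural; exact census of this seat: 0 violations (`n ≤ 7`, `q` from `1/100` to `2`). [cite: Grimmett2006, §3.9 (pp. 63–65)] -/
def ClusterDomAdjLevelOn (V : Type*) [Fintype V] (q : ℝ) : Prop :=
  ∀ (w : Sym2 V → unitInterval) (x z : V) (𝒰 : Set (Set V)), IsUpperSet 𝒰 → ∀ m : ℕ, 0 ≤ rcLevelCross w q x z 𝒰 m

/-- **Levelwise MM for every `q > 0` on every finite weighted graph.**  CONJECTURE-SHAPED STATEMENT, NOT asserted; implies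
`ClusterDomAdjFKPos` (`clusterDomAdjFKPos_of_level`). [cite: Grimmett2006, §3.9 (pp. 63–65)] -/
@[conjecture] def ClusterDomAdjLevelPos : Prop := ∀ q : ℝ, 0 < q → ∀ n : ℕ, ClusterDomAdjLevelOn (Fin n) q

/-- **Levelwise forest-MM on the vertex type `V`**.  Conjectural; exact census of this seat: 0 violations (`K₄ … K₈`, random graphs on
`≤ 7` vertices, all up-sets per level). [cite: AyyerLinussonRavichandran2025, §7 Conj. 7.1 (p. 22)] -/
def ArborealClusterDomAdjLevelOn (V : Type*) [Fintype V] : Prop :=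
  ∀ (w : Sym2 V → unitInterval) (x z : V) (𝒰 : Set (Set V)), IsUpperSet 𝒰 → ∀ m : ℕ, 0 ≤ agLevelCross w x z 𝒰 m

/-- **Levelwise forest-MM on every finite weighted graph.**  CONJECTURE-SHAPED STATEMENT, NOT asserted; implies `ArborealClusterDomAdjPos`
(`arborealClusterDomAdjPos_of_level`), hence forest-CA, ALR's Conjecture 7.1 and adjacent-pair negative correlation of the arboreal gas
(fk-1 g9/g10 kernel reductions). [cite: AyyerLinussonRavichandran2025, §7 Conj. 7.1 (p. 22)] -/
@[conjecture] def ArborealClusterDomAdjLevelPos : Prop := ∀ n : ℕ, ArborealClusterDomAdjLevelOn (Fin n)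

/-! ### Summing the levels -/

omit [Fintype V] in
/-- A configuration has at most `|Sym2 V|` open pairs. [folklore] -/
theorem ncard_le_card_sym2 [Fintype V] (ω : BondConfig V) : ω.ncard ≤ Fintype.card (Sym2 V) := by
  have h := Set.ncard_le_ncard (Set.subset_univ ω) Set.finite_univ
  rwa [Set.ncard_univ, Nat.card_eq_fintype_card] at h

/-- **Summing all levels recovers the full double sum**: with `N = 2·|Sym2 V| + 1`,
`Σ_{m < N} Σ_{ω,ω'} [|ω|+|ω'| = m]·F(ω,ω') = Σ_{ω,ω'} F(ω,ω')`. [folklore] -/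
theorem sum_range_level_eq (F : BondConfig V → BondConfig V → ℝ) :
    ∑ m ∈ Finset.range (2 * Fintype.card (Sym2 V) + 1), ∑ ω : BondConfig V, ∑ ω' : BondConfig V,
        (if ω.ncard + ω'.ncard = m then (1 : ℝ) else 0) * F ω ω' =
      ∑ ω : BondConfig V, ∑ ω' : BondConfig V, F ω ω' := by
  rw [Finset.sum_comm]
  refine Finset.sum_congr rfl fun ω _ => ?_
  rw [Finset.sum_comm]
  refine Finset.sum_congr rfl fun ω' _ => ?_
  simp_rw [boole_mul]
  rw [Finset.sum_ite_eq]
  have hlt : ω.ncard + ω'.ncard ∈ Finset.range (2 * Fintype.card (Sym2 V) + 1) := by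
    rw [Finset.mem_range]
    have h1 := ncard_le_card_sym2 ω
    have h2 := ncard_le_card_sym2 ω'
    omega
  rw [if_pos hlt]

/-- The double sum of `a(ω)b(ω')(ι(ω) − ι(ω'))` is the cross difference `(Σ aι)(Σ b) − (Σ a)(Σ bι)`. [folklore] -/
theorem sum_sum_cross_eq (a b ι : BondConfig V → ℝ) :
    ∑ ω : BondConfig V, ∑ ω' : BondConfig V, a ω * b ω' * (ι ω - ι ω') =
      (∑ ω : BondConfig V, a ω * ι ω) * (∑ ω : BondConfig V, b ω) -
        (∑ ω : BondConfig V, a ω) * (∑ ω : BondConfig V, b ω * ι ω) := by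
  have h1 : ∑ ω : BondConfig V, ∑ ω' : BondConfig V, a ω * b ω' * (ι ω - ι ω') =
      ∑ ω : BondConfig V, (a ω * ι ω * ∑ ω' : BondConfig V, b ω' - a ω * ∑ ω' : BondConfig V, b ω' * ι ω') := by
    refine Finset.sum_congr rfl fun ω _ => ?_
    rw [Finset.mul_sum, Finset.mul_sum, ← Finset.sum_sub_distrib]
    exact Finset.sum_congr rfl fun ω' _ => by ring
  rw [h1, Finset.sum_sub_distrib, ← Finset.sum_mul, ← Finset.sum_mul]

/-! ### Level ⇒ MM, level ⇒ forest-MM -/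

/-- **Levelwise forest-MM ⇒ forest-MM** (kernel reduction): the levels sum to `S₁Z₀ − S₀Z₁`, and `S₀Z₁ ≤ S₁Z₀` for all data is forest-MM
(`clusterDomAdjOn_of_sum_cross`). [cite: AyyerLinussonRavichandran2025, §7 Conj. 7.1 (p. 22)] [cite: Grimmett2006, §1.5 eq. (1.22) (p. 13)] -/
theorem arborealClusterDomAdjOn_of_level (h : ArborealClusterDomAdjLevelOn V) : ArborealClusterDomAdjOn V := by
  refine clusterDomAdjOn_of_sum_cross fun w x z 𝒰 h𝒰 => ?_
  have hsum : 0 ≤ ∑ m ∈ Finset.range (2 * Fintype.card (Sym2 V) + 1), agLevelCross w x z 𝒰 m :=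
    Finset.sum_nonneg fun m _ => h w x z 𝒰 h𝒰 m
  unfold agLevelCross at hsum
  rw [sum_range_level_eq, sum_sum_cross_eq] at hsum
  unfold agPartition
  linarith

/-- **`ArborealClusterDomAdjLevelPos → ArborealClusterDomAdjPos`.** [cite: AyyerLinussonRavichandran2025, §7 Conj. 7.1 (p. 22)] -/
theorem arborealClusterDomAdjPos_of_level (h : ArborealClusterDomAdjLevelPos) : ArborealClusterDomAdjPos :=
  fun n => arborealClusterDomAdjOn_of_level (h n)

/-- **Levelwise MM ⇒ MM** for `φ_{w,q}`, `q > 0`: the levels sum to `S₁Z₀ − S₀Z₁` and `φ_{w[f↦b]}(C_x ∈ 𝒰) = S_b/Z_b` with `Z_b > 0`.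
[cite: Grimmett2006, Thm. (3.21) (p. 43); §1.4 eq. (1.20) (p. 15)] -/
theorem clusterDomAdjOn_of_level {q : ℝ} (hq : 0 < q) (h : ClusterDomAdjLevelOn V q) : ClusterDomAdjOn V q := by
  intro w x z 𝒰 h𝒰
  have hsum : 0 ≤ ∑ m ∈ Finset.range (2 * Fintype.card (Sym2 V) + 1), rcLevelCross w q x z 𝒰 m :=
    Finset.sum_nonneg fun m _ => h w x z 𝒰 h𝒰 m
  unfold rcLevelCross at hsum
  rw [sum_range_level_eq, sum_sum_cross_eq] at hsum
  have hZ1 := rcPartitionFunctionW_pos (Function.update w s(x, z) 1) hq (∅ : Set V)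
  have hZ0 := rcPartitionFunctionW_pos (Function.update w s(x, z) 0) hq (∅ : Set V)
  rw [rcMeasureW_real_eq_sum_div _ hq, rcMeasureW_real_eq_sum_div _ hq, div_le_div_iff₀ hZ0 hZ1]
  unfold rcPartitionFunctionW
  linarith

/-- `ClusterDomAdjLevelOn (Fin n) q` for all `n` gives `ClusterDomAdjFK q`. [cite: Grimmett2006, §3.9 (pp. 63–65)] -/
theorem clusterDomAdjFK_of_level {q : ℝ} (hq : 0 < q) (h : ∀ n : ℕ, ClusterDomAdjLevelOn (Fin n) q) : ClusterDomAdjFK q :=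
  fun n => clusterDomAdjOn_of_level hq (h n)

/-- **`ClusterDomAdjLevelPos → ClusterDomAdjFKPos`** (hence, by fk-1 g7/g8, CA, the hub inequality, adjacent-edge NC for `q < 1`, and
by fk-1 g9 ALR's Conjecture 7.1 for the arboreal gas). [cite: Grimmett2006, §3.9 (pp. 63–65)] [cite: AyyerLinussonRavichandran2025, §7 Conj. 7.1 (p. 22)] -/
theorem clusterDomAdjFKPos_of_level (h : ClusterDomAdjLevelPos) : ClusterDomAdjFKPos :=
  fun q hq => clusterDomAdjFK_of_level hq (h q hq)

end FK

end Summit.CriticalPhenomena.PercolationContinuityZ3.Theorems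

end
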